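/-
Copyright (c) 2026. All rights reserved.
Released under Apache 2.0 license as described in the file LICENSE.
Authors: abc-iut cell, campaign-S prover seat abc-iut-S1 (wave 1, gen 7).
-/
import Summits.ABC.IUTFork.Cor312Ind3IteratesVacuityDyadicOcticGaussian
import Literature.IUT.LogVolume.UnitLogCyclotomicSixteen
import HarnessLib

/-!
# (Ind3) honest iterates at the `(8, 1)`-places of fields containing `ζ₁₆`: depth `≥ 2` is EMPTY — and the `(8, 1)`-pair

Proof-only sequel (theorems, no definitions) of `Cor312Ind3IteratesVacuityDyadicQuartic.lean` (`F ∋ √−1`,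
`(4, 1)` ⇒ empty) and `Cor312Ind3IteratesVacuityDyadicOcticGaussian.lean` (`ℚ(⁸√−25)`: `(8, 1)`, `∋ √−1`,
inhabited), transporting abc-iut-S1's `WildDyadicQuartic.logUnits_inter_sphere_eq_empty_of_eight_of_pow_eight_eq_neg_one`
(`e = 8`, `f = 1`, `ξ⁸ = −1` ⇒ `log₂(𝒪_K^×)` misses `𝒪_K^×`) to the completions:

* `Real.nonarchIterImage_add_two_eq_empty_of_octic_of_pow_eight_eq_neg_one` — **`F ∋ ξ` with `ξ⁸ = −1`
  (so `F ∋ √−1 = ξ⁴`), `v ∣ 2` with `(e, f)(v|2) = (8, 1)` ⇒ every honest depth-`≥ 2` image at `v` is EMPTY**;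
  column level `Column.unitImage_add_two_eq_empty_of_honestImages_of_cyclotomic_sixteen`.
* `exists_numberField_cyclotomic_sixteen_dyadic_eq_empty` — **`F = ℚ(ζ₁₆)`: `F ∋ √−1`, its place over `2` has
  `(e, f) = (8, 1)` and EMPTY depth `≥ 2`**; with `ℚ(⁸√−25)`: `exists_octic_gaussian_dyadic_pair` — **even among
  number fields containing `√−1` ([IUTchI] Def. 3.1), at `(e, f)(v|2) = (8, 1)` the honest (Ind3) census bit is
  NOT a function of `(e, f)`** (at `(4, 1)` it is: empty).

Honest framing: statements ABOUT THE MODEL; classical local arithmetic underneath; nothing here asserts or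
denies [IUTchIII] Cor. 3.12 or takes a side; census ≠ verdict; typed ≠ proved.  No definitions, no Prop fact.
-/

noncomputable section

open Set

namespace Summit.ABC.IUTFork.Thm311.Real

open NumberField IsDedekindDomain Literature.IUT.LogVolume Literature.IUT.LogThetaLattice
  Literature.NumberTheory.NumberFields Polynomial

variable {F : Type} [Field F] [NumberField F]

/-! ## 1. `F ∋ ξ`, `ξ⁸ = −1`, `(e, f)(v|2) = (8, 1)`: depth `≥ 2` is empty -/

/-- In the rescaled completion at a place over `p = 2` with `(e, f)(v|2) = (8, 1)` containing `ξ` with `ξ⁸ = −1`,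
no `unitLog` value has norm `1`. [cite: Koblitz1984, Ch. IV §2] -/
theorem norm_rescaled_unitLog_ne_one_of_octic_of_pow_eight_eq_neg_one (v : HeightOneSpectrum (𝓞 F)) (p : ℕ)
    [Fact p.Prime] (hv : ((p : ℕ) : 𝓞 F) ∈ v.asIdeal) (hp2 : p = 2) (he : v.asIdeal.ramificationIdx ℤ = 8)
    (hf : v.asIdeal.inertiaDeg ℤ = 1) {ξ : RescaledCompletion F p v hv} (hξ : ξ ^ 8 = -1)
    (x : RescaledCompletion F p v hv) : ‖unitLog x‖ ≠ 1 := by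
  subst hp2
  have he' : absRamificationIdx 2 (RescaledCompletion F 2 v hv) = 8 := by
    rw [absRamificationIdx_rescaledCompletion, he]
  have hf' : residueDegree 2 (RescaledCompletion F 2 v hv) = 1 := by
    rw [residueDegree_rescaledCompletion, hf]
  intro hx
  by_cases hxu : ‖x‖ = 1
  · have hmem : unitLog x ∈ logUnits (RescaledCompletion F 2 v hv) ∩ Metric.sphere 0 1 :=
      ⟨unitLog_mem_logUnits hxu, mem_sphere_zero_iff_norm.mpr hx⟩
    rw [WildDyadicQuartic.logUnits_inter_sphere_eq_empty_of_eight_of_pow_eight_eq_neg_one he' hf' hξ] at hmem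
    exact hmem
  · rw [unitLog_of_norm_ne_one hxu, norm_zero] at hx
    exact zero_ne_one hx

/-- **`F ∋ ξ`, `ξ⁸ = −1`; `v ∣ 2` with `(e, f)(v|2) = (8, 1)` ⇒ the analytic logarithm of a unit of `O_v` is never
a unit of `O_v`.** [cite: Koblitz1984, Ch. IV §2] -/
theorem analyticLogv_ne_coe_unit_of_octic_of_pow_eight_eq_neg_one (v : HeightOneSpectrum (𝓞 F))
    (h2 : ((2 : ℕ) : 𝓞 F) ∈ v.asIdeal) (he : v.asIdeal.ramificationIdx ℤ = 8) (hf : v.asIdeal.inertiaDeg ℤ = 1)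
    {ξ : F} (hξ : ξ ^ 8 = -1) (w u : (↥(integers v))ˣ) :
    analyticLogv F v (Additive.ofMul w) ≠ ((u : ↥(integers v)) : Carrier (.inr v : Place F)) := by
  haveI : Fact (residueChar F v).Prime := ⟨residueChar_prime F v⟩
  have hp : residueChar F v = 2 := residueChar_eq_of_prime_natCast_mem v Nat.prime_two h2
  have hξ' : (RescaledCompletion.of F (residueChar F v) v (natCast_residueChar_mem F v)
      (algebraMap F (v.adicCompletion F) ξ)) ^ 8 = -1 := by
    rw [← map_pow, ← map_pow, hξ, map_neg, map_one, map_neg, map_one]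
  intro h
  have h1 := norm_rescaled_unitLog_ne_one_of_octic_of_pow_eight_eq_neg_one v (residueChar F v)
    (natCast_residueChar_mem F v) hp he hf hξ' (RescaledCompletion.of F (residueChar F v) v
      (natCast_residueChar_mem F v) ((w : ↥(integers v)) : Carrier (.inr v : Place F)))
  apply h1
  have h' := congrArg (RescaledCompletion.of F (residueChar F v) v (natCast_residueChar_mem F v)) h
  rw [analyticLogv_apply, RingEquiv.apply_symm_apply] at h'
  rw [h']
  exact norm_of_coe_unit_adicCompletionIntegers F (residueChar F v) v (natCast_residueChar_mem F v) u

/-- **`F ∋ ξ` with `ξ⁸ = −1` (e.g. `F ⊇ ℚ(ζ₁₆)`); `v ∣ 2` with `(e, f)(v|2) = (8, 1)` ⇒ every honest depth-`≥ 2`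
(Ind3) iterate image at `v` is EMPTY.** [claim: Mochizuki2012, status: disputed] -/
theorem nonarchIterImage_add_two_eq_empty_of_octic_of_pow_eight_eq_neg_one (v : HeightOneSpectrum (𝓞 F))
    (h2 : ((2 : ℕ) : 𝓞 F) ∈ v.asIdeal) (he : v.asIdeal.ramificationIdx ℤ = 8) (hf : v.asIdeal.inertiaDeg ℤ = 1)
    {ξ : F} (hξ : ξ ^ 8 = -1) (k : ℕ) : nonarchIterImage (analyticLogv F) v (k + 2) = ∅ :=
  nonarchIterImage_add_two_eq_empty_of_forall_ne (analyticLogv F) v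
    (fun w u => analyticLogv_ne_coe_unit_of_octic_of_pow_eight_eq_neg_one v h2 he hf hξ w u) k

/-- **Column level** (pilot data over `F ∋ ζ₁₆`, honest unit images; a place `w ∣ 2` with `(e, f) = (8, 1)`):
the unit image at `(m, m′ + 2, j, v_ℚ)` is `∅`. [claim: Mochizuki2012, status: disputed] -/
theorem _root_.Summit.ABC.IUTFork.Thm311.Column.unitImage_add_two_eq_empty_of_honestImages_of_cyclotomic_sixteen
    (X : PilotData F) (C : Column (logShellsDH X (analyticLogv F)))
    (hunit : ∀ (m : ℤ) (m' : ℕ) (j : (thetaIndex X).Label) (vQ : (thetaIndex X).VQ),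
      C.unitImage m m' j vQ =
        (logShellsDH X (analyticLogv F)).tprodImages j vQ (honestU X (analyticLogv F) m m' vQ))
    {ξ : F} (hξ : ξ ^ 8 = -1) (m : ℤ) (k : ℕ) (j : (thetaIndex X).Label) {vQ : (thetaIndex X).VQ}
    (w : HeightOneSpectrum (𝓞 F)) (hw : (thetaIndex X).over (.inr w) = vQ)
    (h2 : ((2 : ℕ) : 𝓞 F) ∈ w.asIdeal) (he : w.asIdeal.ramificationIdx ℤ = 8) (hf : w.asIdeal.inertiaDeg ℤ = 1) :
    C.unitImage m (k + 2) j vQ = ∅ := by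
  rw [hunit]
  exact LogShells.tprodImages_eq_empty_of_eq_empty _ j vQ _ ⟨.inr w, hw⟩
    (nonarchIterImage_add_two_eq_empty_of_octic_of_pow_eight_eq_neg_one w h2 he hf hξ k)

/-! ## 2. F-level: `ℚ(ζ₁₆)` and the `(8, 1)`-pair among fields containing `√−1` -/

/-- **`ξ⁸ = −1` in `K_v`, `2 ∈ 𝔭_v` ⇒ `8 ≤ e(v|2)`** (`‖(ξ − 1)⁸‖_v = ‖2‖_v`, abc-iut-S1's
`WildDyadicQuartic.norm_pow_eight_sub_one_of_pow_eight_eq_neg_one`). [cite: NeukirchANT1999, Ch. II (5.5)] -/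
theorem eight_le_ramificationIdx_of_pow_eight_eq_neg_one (v : HeightOneSpectrum (𝓞 F))
    (h2 : ((2 : ℕ) : 𝓞 F) ∈ v.asIdeal) (x : v.adicCompletion F) (hx : x ^ 8 = -1) :
    8 ≤ v.asIdeal.ramificationIdx ℤ := by
  set ξ : RescaledCompletion F 2 v h2 := RescaledCompletion.of F 2 v h2 x with hξdef
  have hξ : ξ ^ 8 = -1 := by rw [hξdef, ← map_pow, hx, map_neg, map_one]
  have hnorm : ‖ξ - 1‖ ^ 8 = 2⁻¹ := by
    rw [← norm_pow]; exact WildDyadicQuartic.norm_pow_eight_sub_one_of_pow_eight_eq_neg_one hξ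
  have h := le_absRamificationIdx_rescaled_of_norm_pow v 2 h2 rfl (by norm_num : 0 < 8) (ξ - 1) hnorm
  rwa [absRamificationIdx_rescaledCompletion] at h

/-- **`F = ℚ[X]/(g)`, `g` an irreducible factor of `X⁸ + 1`**: a number field of degree `≤ 8` with `ξ⁸ = −1`
(i.e. `ℚ(ζ₁₆)`). [folklore] -/
theorem exists_numberField_pow_eight_eq_neg_one_finrank_le :
    ∃ (F : Type) (_ : Field F) (_ : NumberField F) (ξ : F), ξ ^ 8 = -1 ∧ Module.finrank ℚ F ≤ 8 := by
  let f : ℚ[X] := X ^ 8 + C (1 : ℚ)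
  have hf : f.natDegree = 8 := natDegree_X_pow_add_C
  have hfne : f.natDegree ≠ 0 := by rw [hf]; norm_num
  haveI : Fact (Irreducible f.factor) := ⟨irreducible_factor f⟩
  have hg0 : f.factor ≠ 0 := (irreducible_factor f).ne_zero
  haveI : Module.Finite ℚ (AdjoinRoot f.factor) := (AdjoinRoot.powerBasis hg0).finite
  haveI : CharZero (AdjoinRoot f.factor) :=
    charZero_of_injective_algebraMap (algebraMap ℚ (AdjoinRoot f.factor)).injective
  haveI : NumberField (AdjoinRoot f.factor) := NumberField.mk
  refine ⟨AdjoinRoot f.factor, inferInstance, inferInstance, AdjoinRoot.root f.factor, ?_, ?_⟩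
  · have hdvd : f.factor ∣ f := factor_dvd_of_natDegree_ne_zero hfne
    have halg : algebraMap ℚ (AdjoinRoot f.factor) = AdjoinRoot.of f.factor := Subsingleton.elim _ _
    have hroot : aeval (AdjoinRoot.root f.factor) f.factor = 0 := by
      rw [aeval_def, halg]
      exact AdjoinRoot.eval₂_root f.factor
    have h0 : aeval (AdjoinRoot.root f.factor) f = 0 := aeval_eq_zero_of_dvd_aeval_eq_zero hdvd hroot
    have h1 : aeval (AdjoinRoot.root f.factor) f = AdjoinRoot.root f.factor ^ 8 + 1 := by
      simp [f]
    rw [h1] at h0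
    linear_combination h0
  · rw [(AdjoinRoot.powerBasis hg0).finrank, AdjoinRoot.powerBasis_dim, ← hf]
    exact natDegree_le_of_dvd (factor_dvd_of_natDegree_ne_zero hfne)
      (monic_X_pow_add_C (1 : ℚ) (by norm_num)).ne_zero

/-- **`ℚ(ζ₁₆)`: a number field CONTAINING `√−1` with a place over `2` of type `(e, f) = (8, 1)` at which EVERY
honest depth-`≥ 2` (Ind3) iterate image is EMPTY.** [claim: Mochizuki2012, status: disputed] -/
theorem exists_numberField_cyclotomic_sixteen_dyadic_eq_empty :
    ∃ (F : Type) (_ : Field F) (_ : NumberField F) (v : HeightOneSpectrum (𝓞 F)),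
      (∃ i : F, i ^ 2 = -1) ∧ residueChar F v = 2 ∧ v.asIdeal.ramificationIdx ℤ = 8 ∧
        v.asIdeal.inertiaDeg ℤ = 1 ∧ ∀ k : ℕ, nonarchIterImage (analyticLogv F) v (k + 2) = ∅ := by
  obtain ⟨F, _, _, ξ, hξ, hdeg⟩ := exists_numberField_pow_eight_eq_neg_one_finrank_le
  obtain ⟨v, hv⟩ := exists_heightOneSpectrum_natCast_mem' (F := F) Nat.prime_two
  have hx : (algebraMap F (v.adicCompletion F) ξ) ^ 8 = -1 := by rw [← map_pow, hξ, map_neg, map_one]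
  have h8 : 8 ≤ v.asIdeal.ramificationIdx ℤ := eight_le_ramificationIdx_of_pow_eight_eq_neg_one v hv _ hx
  have hef : v.asIdeal.ramificationIdx ℤ * v.asIdeal.inertiaDeg ℤ ≤ 8 :=
    (ramificationIdx_mul_inertiaDeg_le_finrank' v).trans hdeg
  haveI := v.isPrime
  have hfpos : 0 < v.asIdeal.inertiaDeg ℤ := Ideal.inertiaDeg_pos (R := ℤ) (q := v.asIdeal)
  have he : v.asIdeal.ramificationIdx ℤ = 8 := by nlinarith
  have hf : v.asIdeal.inertiaDeg ℤ = 1 := by nlinarith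
  have hi : (ξ ^ 4) ^ 2 = -1 := by rw [← pow_mul]; exact hξ
  exact ⟨F, inferInstance, inferInstance, v, ⟨ξ ^ 4, hi⟩,
    residueChar_eq_of_prime_natCast_mem v Nat.prime_two hv, he, hf,
    fun k => nonarchIterImage_add_two_eq_empty_of_octic_of_pow_eight_eq_neg_one v hv he hf hξ k⟩

/-- **THE `(8, 1)`-PAIR AMONG FIELDS CONTAINING `√−1`.**  There are number fields `F₁ = ℚ(ζ₁₆)` and
`F₂ = ℚ(⁸√−25)`, both containing `√−1`, with places `v₁, v₂` over `2`, both of type `(e, f) = (8, 1)`, such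
that the honest depth-`2` (Ind3) iterate image is EMPTY at `v₁` and INHABITED at `v₂`: for the fields of
[IUTchI] Def. 3.1 the census bit at `(8, 1)` is NOT a function of `(e, f)` (whereas at `(4, 1)` it is: empty,
`Cor312Ind3IteratesVacuityDyadicQuartic`). [claim: Mochizuki2012, status: disputed] -/
theorem exists_octic_gaussian_dyadic_pair :
    (∃ (F : Type) (_ : Field F) (_ : NumberField F) (v : HeightOneSpectrum (𝓞 F)),
      (∃ i : F, i ^ 2 = -1) ∧ residueChar F v = 2 ∧ v.asIdeal.ramificationIdx ℤ = 8 ∧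
        v.asIdeal.inertiaDeg ℤ = 1 ∧ nonarchIterImage (analyticLogv F) v 2 = ∅) ∧
    (∃ (F : Type) (_ : Field F) (_ : NumberField F) (v : HeightOneSpectrum (𝓞 F)),
      (∃ i : F, i ^ 2 = -1) ∧ residueChar F v = 2 ∧ v.asIdeal.ramificationIdx ℤ = 8 ∧
        v.asIdeal.inertiaDeg ℤ = 1 ∧ (nonarchIterImage (analyticLogv F) v 2).Nonempty) := by
  refine ⟨?_, exists_numberField_octic_gaussian_dyadic_two_nonempty⟩
  obtain ⟨F, _, _, v, hi, hp, he, hf, hall⟩ := exists_numberField_cyclotomic_sixteen_dyadic_eq_empty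
  exact ⟨F, inferInstance, inferInstance, v, hi, hp, he, hf, hall 0⟩

end Summit.ABC.IUTFork.Thm311.Real

end
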